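import Summits.QuantumFields.YangMills.Theorems.LuscherReductionTwistedTraceScalingBTTauBudget
import HarnessLib

/-!
# Tail kernel bounds WITH THE MAGNETIC FACTOR: `K_β(oT u v, (oT u' v')^g) ≤ e^{β(2|E| − kinDefect)}·e^{−(β/2)L³(S₁u + S₁u') + βE(τ,σ)}` on the tube, hence in one-site units
# `fpBOKernel(W')(u,u')/K₁^{(L³β)}(u,u') ≤ e^{L³β·Σ_k‖q(u_k)−q(u'_k)‖²}·e^{−βm + βE}·(∫Ω)²` for a weight `W' ≤ 1` supported where `kinDefect ≥ m`
# (route `FlatTubeReduction`, crux K1 `NearFlatRatioLaw` stmt-QuantumFields-24720; seat `ym-line-ftr-p1` g15; rate twin «ratepack-v3 / frozen fibres»; R2b1 RECORD rung — no summit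
# statement is proved here)

WHY (memo `Cruxes/NearFlatRatioLaw/Lines/ratepack-v3-frozen-g12.md` §8.4; PICKED.md g15; NOTES design T4a).  The dressed kernel comparison of the rate twin is stated in one-site units
`F(a,b) = fpBOKernel(a,b)/K₁^{(B)}(a,b)`, `B = L³β`; the one-site diagonal kernel `K₁(u,u) = e^{6B − B·S₁(u)}` is SMALLER than the crude sup `e^{2β|E|} = e^{6B}` by `e^{−BS₁(u)}`, and on the
`β^{-1/6}` window `B·S₁(u) ≲ 12L³βδ₁⁴ ≍ β^{1/3}` — so lane A's absolute tail bound `fpBOKernel(tail) ≤ e^{2β|E|}e^{−βm}(∫Ω)²` (`…BTTails`, `…BTFixedBeta`) is useless in `F`-units.  The cure is to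
keep the magnetic energy of the two slices in the kernel bound (`transferKernel_gaugeTransform_eq` is exact; `wilsonAction_orthoTube_ge` gives `S(oT u v) ≥ L³S₁(u) − E(τ,σ)`), after which the
tail in `F`-units carries only the kinetic one-site defect `e^{B(6 − TC₁(u,u'))} = e^{BΣ_k‖q(u_k) − q(u'_k)‖²}` (`≤ e^{3Bα²}` for near pairs, `= 1` on the diagonal):
* ★ `transferKernel_tube_gauge_le_mag` — the kernel bound; `six_sub_timeCoupling_one_site` — `6 − TC₁(u,u') = Σ_k ‖q(u_k) − q(u'_k)‖²`; `transferKernel_one_site_eq` — `K₁^{(B)}(u,u')` explicitly;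
* ★★ `fpBOKernel_tail_div_le` — the tail in one-site units.
HONEST FRAMING: bookkeeping for a stub of the CONDITIONAL reduction route R2b1; femto rung R2b1 (RECORD label); not infinite volume, not a gap, not Clay.  No defs, no named facts, no `sorry`.
-/

set_option autoImplicit false

noncomputable section

open MeasureTheory Filter Topology Real
open scoped BigOperators Quaternion
open Literature.MathematicalPhysics.QuantumFieldTheory
open Literature.MathematicalPhysics.QuantumLattice

namespace Summit.QuantumFields.YangMills.Theorems.FemtoTransferGap.TwoLattice.ConstTube

open Summit.QuantumFields.YangMills.Theorems.FemtoTransferGap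
open Summit.QuantumFields.YangMills.Theorems.FemtoTransferGap.TwoLattice
open Summit.QuantumFields.YangMills.Theorems.FemtoTransferGap.TwoLattice.Avg
open Summit.QuantumFields.YangMills.Theorems.FemtoTransferGap.TwoLattice.Cov
open Summit.QuantumFields.YangMills.Theorems.FemtoTransferGap.TwoLattice.Stiff (LinkSpace)

variable {L : ℕ} [NeZero L]

/-! ## §1 The kernel on the tube with the magnetic factor kept -/

/-- ★ **Tube kernel bound with the magnetic factor**: for cap-balanced `v, v'` with `|v_{e,c}|, |v'_{e,c}| ≤ τ ≤ 1/30`, `L³S₁(u), L³S₁(u') ≤ σ < 2`, `β ≥ 0`: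
`K_β(oT u v, (oT u' v')^g) ≤ exp(β(2|E| − kinDefect)) · exp(−(β/2)(L³S₁(u) + L³S₁(u')) + β·E(τ,σ))`. [cite: Luscher1983, §3] -/
theorem transferKernel_tube_gauge_le_mag {β : ℝ} (hβ : 0 ≤ β) (u u' : GaugeConfig 3 1 SU2) {v v' : Edge 3 L → Fin 3 → ℝ} (hv : v ∈ capBalancedSet L)
    (hv' : v' ∈ capBalancedSet L) {τ σ : ℝ} (hτ : τ ≤ 1 / 30) (hσ : σ < 2) (hS : (L : ℝ) ^ 3 * wilsonAction su2Rep u ≤ σ) (hS' : (L : ℝ) ^ 3 * wilsonAction su2Rep u' ≤ σ)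
    (hvτ : ∀ (e : Edge 3 L) (c : Fin 3), |v e c| ≤ τ) (hv'τ : ∀ (e : Edge 3 L) (c : Fin 3), |v' e c| ≤ τ) (g : Site 3 L → SU2) :
    transferKernel su2Rep β (orthoTube L u v) (gaugeTransform g (orthoTube L u' v')) ≤
      Real.exp (β * (2 * (Fintype.card (Edge 3 L) : ℝ) - kinDefect L (orthoTube L u v) (orthoTube L u' v') g)) *
        Real.exp (-(β / 2) * ((L : ℝ) ^ 3 * wilsonAction su2Rep u + (L : ℝ) ^ 3 * wilsonAction su2Rep u') + β * stepActionErr (L := L) τ σ) := by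
  rw [transferKernel_gaugeTransform_eq, ← Real.exp_add]
  refine Real.exp_le_exp.mpr ?_
  have h1 := wilsonAction_orthoTube_ge u hv hτ hσ hS hvτ
  have h2 := wilsonAction_orthoTube_ge u' hv' hτ hσ hS' hv'τ
  have hσ0 : 0 ≤ σ := le_trans (mul_nonneg (by positivity) (wilsonAction_su2_nonneg u)) hS
  have hq1 : 0 ≤ (1 - σ / 2) * ‖covCurl (constLift L u) (linkEmbed L v)‖ ^ 2 := mul_nonneg (by linarith) (sq_nonneg _)
  have hq2 : 0 ≤ (1 - σ / 2) * ‖covCurl (constLift L u') (linkEmbed L v')‖ ^ 2 := mul_nonneg (by linarith) (sq_nonneg _)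
  nlinarith [mul_le_mul_of_nonneg_left (add_le_add h1 h2) hβ]

/-! ## §2 The one-site kernel explicitly -/

omit [NeZero L] in
/-- `6 − TC₁(u,u') = Σ_k ‖q(u_k) − q(u'_k)‖²`. [folklore] -/
theorem six_sub_timeCoupling_one_site (u u' : GaugeConfig 3 1 SU2) :
    6 - timeCoupling su2Rep u u' = ∑ e : Edge 3 1, ‖su2Quat (u e) - su2Quat (u' e)‖ ^ 2 := by
  unfold timeCoupling
  simp only [re_trace_su2Rep_mul_inv_eq_norm, Finset.sum_sub_distrib, Finset.sum_const, Finset.card_univ, card_edge_one, nsmul_eq_mul]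
  norm_num

omit [NeZero L] in
/-- `K₁^{(B)}(u,u') = exp(6B − B·Σ_k‖q(u_k) − q(u'_k)‖² − (B/2)(S₁(u) + S₁(u')))`. [folklore] -/
theorem transferKernel_one_site_eq (B : ℝ) (u u' : GaugeConfig 3 1 SU2) :
    transferKernel su2Rep B u u' = Real.exp (6 * B - B * ∑ e : Edge 3 1, ‖su2Quat (u e) - su2Quat (u' e)‖ ^ 2 - B / 2 * (wilsonAction su2Rep u + wilsonAction su2Rep u')) := by
  unfold transferKernel
  rw [← six_sub_timeCoupling_one_site]; ring_nf

/-! ## §3 ★★ Tails in one-site units -/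

/-- ★★ **The tail in one-site units.**  `β ≥ 0`; `Ω ∈ [0, CΩ]` measurable, supported in `{cap-balanced, |v_{e,c}| ≤ τ}`, `τ ≤ 1/30`; `W' ∈ [0,1]` measurable; window actions
`L³S₁(u), L³S₁(u') ≤ σ < 2`; and `kinDefect(oT u v, oT u' v', g) ≥ m` on `supp Ω × supp Ω × supp W'`.  Then
`fpBOKernel β Ω W' u u' / K₁^{(L³β)}(u,u') ≤ exp(L³β·Σ_k‖q(u_k) − q(u'_k)‖²)·exp(−βm + β·E(τ,σ))·(∫Ω dπ)²`. [cite: Luscher1983, §3] -/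
theorem fpBOKernel_tail_div_le {β : ℝ} (hβ : 0 ≤ β) {Ω : LinkSpace L → ℝ} (hΩm : Measurable Ω) {CΩ : ℝ} (hCΩ : ∀ x, |Ω x| ≤ CΩ) (hΩ0 : ∀ x, 0 ≤ Ω x)
    {W' : (Site 3 L → SU2) → ℝ} (hW : Measurable W') (hW01 : ∀ g, 0 ≤ W' g ∧ W' g ≤ 1) (u u' : GaugeConfig 3 1 SU2) {τ σ m : ℝ} (hτ : τ ≤ 1 / 30) (hσ : σ < 2)
    (hS : (L : ℝ) ^ 3 * wilsonAction su2Rep u ≤ σ) (hS' : (L : ℝ) ^ 3 * wilsonAction su2Rep u' ≤ σ)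
    (hΩt : ∀ v : Edge 3 L → Fin 3 → ℝ, Ω (linkEmbed L v) ≠ 0 → ∀ (e : Edge 3 L) (c : Fin 3), |v e c| ≤ τ)
    (hm : ∀ (v v' : Edge 3 L → Fin 3 → ℝ) (g : Site 3 L → SU2), v ∈ capBalancedSet L → v' ∈ capBalancedSet L → Ω (linkEmbed L v) ≠ 0 → Ω (linkEmbed L v') ≠ 0 →
      W' g ≠ 0 → m ≤ kinDefect L (orthoTube L u v) (orthoTube L u' v') g) :
    fpBOKernel L β Ω W' u u' / transferKernel su2Rep ((L : ℝ) ^ 3 * β) u u' ≤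
      Real.exp ((L : ℝ) ^ 3 * β * ∑ e : Edge 3 1, ‖su2Quat (u e) - su2Quat (u' e)‖ ^ 2) * Real.exp (-(β * m) + β * stepActionErr (L := L) τ σ) *
        (∫ v, Ω (linkEmbed L v) ∂orthoTransverse L) ^ 2 := by
  have hK : 0 < transferKernel su2Rep ((L : ℝ) ^ 3 * β) u u' := transferKernel_pos _ _ _ _
  -- the pointwise kernel bound on the support
  set M : ℝ := Real.exp (β * (2 * (Fintype.card (Edge 3 L) : ℝ) - m)) *
    Real.exp (-(β / 2) * ((L : ℝ) ^ 3 * wilsonAction su2Rep u + (L : ℝ) ^ 3 * wilsonAction su2Rep u') + β * stepActionErr (L := L) τ σ) with hMdef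
  have hM0 : 0 ≤ M := by rw [hMdef]; positivity
  have hk : ∀ (v v' : Edge 3 L → Fin 3 → ℝ) (g : Site 3 L → SU2), v ∈ capBalancedSet L → v' ∈ capBalancedSet L → Ω (linkEmbed L v) ≠ 0 → Ω (linkEmbed L v') ≠ 0 →
      W' g ≠ 0 → transferKernel su2Rep β (orthoTube L u v) (gaugeTransform g (orthoTube L u' v')) ≤ M := by
    intro v v' g hv hv' hΩv hΩv' hg
    refine (transferKernel_tube_gauge_le_mag hβ u u' hv hv' hτ hσ hS hS' (hΩt v hΩv) (hΩt v' hΩv') g).trans ?_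
    rw [hMdef]
    refine mul_le_mul_of_nonneg_right (Real.exp_le_exp.mpr ?_) (Real.exp_pos _).le
    nlinarith [hm v v' g hv hv' hΩv hΩv' hg]
  have h := fpBOKernel_le_of_kernel_le β hΩm hCΩ hΩ0 hW (fun g => by rw [abs_of_nonneg (hW01 g).1]; exact (hW01 g).2) (fun g => (hW01 g).1) u u' hM0 hk
  have hW1 := integral_weight_le_one hW hW01
  have hI2 : 0 ≤ (∫ v, Ω (linkEmbed L v) ∂orthoTransverse L) ^ 2 := sq_nonneg _
  have h' : fpBOKernel L β Ω W' u u' ≤ M * (∫ v, Ω (linkEmbed L v) ∂orthoTransverse L) ^ 2 := by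
    refine h.trans ?_
    have := mul_le_mul_of_nonneg_left hW1 hM0
    nlinarith [mul_le_mul_of_nonneg_right this hI2]
  rw [div_le_iff₀ hK]
  refine h'.trans (le_of_eq ?_)
  -- `M = e^{BΣ‖Δ‖²}·e^{−βm + βE}·K₁(u,u')`
  rw [hMdef, transferKernel_one_site_eq, card_edge_three, ← Real.exp_add, ← Real.exp_add]
  have e1 : ∀ x y : ℝ, Real.exp x * (∫ v, Ω (linkEmbed L v) ∂orthoTransverse L) ^ 2 = Real.exp y * (∫ v, Ω (linkEmbed L v) ∂orthoTransverse L) ^ 2 * Real.exp (x - y) := by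
    intro x y; rw [mul_assoc, mul_comm ((∫ v, Ω (linkEmbed L v) ∂orthoTransverse L) ^ 2), ← mul_assoc, ← Real.exp_add]; ring_nf
  rw [e1 _ ((L : ℝ) ^ 3 * β * ∑ e : Edge 3 1, ‖su2Quat (u e) - su2Quat (u' e)‖ ^ 2 + (-(β * m) + β * stepActionErr (L := L) τ σ))]
  congr 1
  congr 1
  ring

end Summit.QuantumFields.YangMills.Theorems.FemtoTransferGap.TwoLattice.ConstTube

end
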